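import Summits.CriticalPhenomena.PercolationContinuityZ3.Theorems.PercNearOneGluingNoHeavyLowerTailAntitheticChangeQuad
import HarnessLib

/-!
# `NoHeavyLowerTail` (stmt-CriticalPhenomena-4575) — antithetic cluster pairs: the OS-CLAIM (two nested arcs pay for two crossed lifted pairs),
# the real inequality behind the bulk classes of THEOREM OS and of THEOREM Λ (prim-hp-2 gen 45; HOME/THEOREM-Cprime-delta2-cycle.md §11,
# HOME/THEOREM-Lambda-ears.md §2)

Support file (`--supports stmt-CriticalPhenomena-4575`, hull-port prover `prim-hp-2`, gen 45).  No definitions, no named facts, no sorries.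

In a bulk class of the one-sided augmentation OS (THEOREM-OS-augmentation.md §1) the four terms are `FG(A) + FG(ℓA) + Δ(P, ℓQ) + Δ(Q, ℓP)` with
runs `P, Q ⊆ A` and lifts `P ⊆ ℓP`, `Q ⊆ ℓQ`, `A ⊆ ℓA ⊇ ℓP, ℓQ`.  Writing `a = F P ≤ a⁺ = F ℓP`, `c = F Q ≤ c⁺ = F ℓQ`, `Â = F A ≤ Â⁺ = F ℓA` (all `≥ 0`,
`a, c ≤ Â`, `a⁺, c⁺ ≤ Â⁺`) and `b, b⁺, d, d⁺, B̂, B̂⁺` for `G`, the class sum is `Â·B̂ + Â⁺·B̂⁺ + (a − c⁺)(b − d⁺) + (c − a⁺)(d − b⁺)`.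
* `Antithetic.Quad.os_claim` — this is `≥ 0`.  Unlike the four-value inequality (`Quad.four_value`: ONE arc pays for ONE pair it contains) the two
  pairs here are each contained only in the larger arc; the smaller arc is needed as well.  Proof (THEOREM-Cprime §11): if `(c − a⁺)(d − b⁺) ≥ 0`
  the four-value inequality for `Â⁺` finishes; otherwise, by symmetry `c > a⁺, d < b⁺` (or the mirror), and either `b ≤ d⁺` (then the first cross
  term is `≥ 0` and `Â⁺B̂⁺ ≥ c·b⁺` absorbs the second) or `b > d⁺` (then `ÂB̂ + Â⁺B̂⁺ ≥ cb + c⁺b⁺` and the total is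
  `≥ (c⁺ − c)(b⁺ − b) + ab + a⁺b⁺ ≥ 0`).
Used by: the bulk lemma of THEOREM OS (Lean plan O2) and the two WINDOW patterns of the bulk lemma of THEOREM Λ (THEOREM-Lambda-ears §2; Lean plan L3).
[cite: VandenbergHaggstromKahn2005, §1 p. 3 (open cluster `C_s`)]
-/

namespace Summit.CriticalPhenomena.PercolationContinuityZ3.Theorems

namespace Antithetic

namespace Quad

/-- **OS-CLAIM.**  `0 ≤ Â·B̂ + Â⁺·B̂⁺ + (a − c⁺)(b − d⁺) + (c − a⁺)(d − b⁺)` whenever `0 ≤ a ≤ a⁺ ≤ Â⁺`, `0 ≤ c ≤ c⁺ ≤ Â⁺`, `a, c ≤ Â` and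
the same for `b, b⁺, d, d⁺, B̂, B̂⁺` (the nesting `Â ≤ Â⁺` is not even needed). [this work] -/
theorem os_claim {A Ap a ap c cp B Bp b bp d dp : ℝ} (h0a : 0 ≤ a) (h0c : 0 ≤ c) (h0b : 0 ≤ b) (h0d : 0 ≤ d)
    (haa : a ≤ ap) (hcc : c ≤ cp) (hbb : b ≤ bp) (hdd : d ≤ dp) (haA : a ≤ A) (hcA : c ≤ A) (hapA : ap ≤ Ap) (hcpA : cp ≤ Ap)
    (hbB : b ≤ B) (hdB : d ≤ B) (hbpB : bp ≤ Bp) (hdpB : dp ≤ Bp) :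
    0 ≤ A * B + Ap * Bp + (a - cp) * (b - dp) + (c - ap) * (d - bp) := by
  have hAB : 0 ≤ A * B := mul_nonneg (h0a.trans haA) (h0b.trans hbB)
  have hfv : 0 ≤ Ap * Bp + (a - cp) * (b - dp) :=
    four_value h0a (h0c.trans hcc) h0b (h0d.trans hdd) (haa.trans hapA) hcpA (hbb.trans hbpB) hdpB
  by_cases hY : 0 ≤ (c - ap) * (d - bp)
  · linarith
  rcases lt_or_ge ap c with hc1 | hc1
  · -- `c > a⁺`, hence `d < b⁺`
    have hd1 : d < bp := by
      by_contra h
      exact hY (mul_nonneg (by linarith) (by linarith))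
    rcases le_or_gt b dp with hb1 | hb1
    · have h1 : 0 ≤ (a - cp) * (b - dp) := mul_nonneg_of_nonpos_of_nonpos (by linarith) (by linarith)
      have h2 : (c - ap) * (bp - d) ≤ Ap * Bp :=
        mul_le_mul (by linarith) (by linarith) (by linarith) (by linarith)
      nlinarith
    · have h1 : c * b ≤ A * B := mul_le_mul hcA hbB h0b (h0c.trans hcA)
      have h2 : cp * bp ≤ Ap * Bp := mul_le_mul hcpA hbpB (h0b.trans hbb) ((h0c.trans hcc).trans hcpA)
      have h3 : (cp - a) * (b - dp) ≤ (cp - a) * b := mul_le_mul_of_nonneg_left (by linarith) (by linarith)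
      have h4 : (c - ap) * (bp - d) ≤ (c - ap) * bp := mul_le_mul_of_nonneg_left (by linarith) (by linarith)
      have h5 : 0 ≤ (cp - c) * (bp - b) := mul_nonneg (by linarith) (by linarith)
      have h6 : 0 ≤ a * b := mul_nonneg h0a h0b
      have h7 : 0 ≤ ap * bp := mul_nonneg (h0a.trans haa) (h0b.trans hbb)
      nlinarith
  · -- `c ≤ a⁺`, hence `d > b⁺` and the mirror argument
    have hd1 : bp < d := by
      by_contra h
      exact hY (mul_nonneg_of_nonpos_of_nonpos (by linarith) (by linarith))
    rcases le_or_gt a cp with ha1 | ha1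
    · have h1 : 0 ≤ (a - cp) * (b - dp) := mul_nonneg_of_nonpos_of_nonpos (by linarith) (by linarith)
      have h2 : (ap - c) * (d - bp) ≤ Ap * Bp :=
        mul_le_mul (by linarith) (by linarith) (by linarith) (by linarith)
      nlinarith
    · have h1 : a * d ≤ A * B := mul_le_mul haA hdB h0d (h0a.trans haA)
      have h2 : ap * dp ≤ Ap * Bp := mul_le_mul hapA hdpB (h0d.trans hdd) ((h0a.trans haa).trans hapA)
      have h3 : (a - cp) * (dp - b) ≤ (a - cp) * dp := mul_le_mul_of_nonneg_left (by linarith) (by linarith)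
      have h4 : (ap - c) * (d - bp) ≤ (ap - c) * d := mul_le_mul_of_nonneg_left (by linarith) (by linarith)
      have h5 : 0 ≤ (ap - a) * (dp - d) := mul_nonneg (by linarith) (by linarith)
      have h6 : 0 ≤ c * d := mul_nonneg h0c h0d
      have h7 : 0 ≤ cp * dp := mul_nonneg (h0c.trans hcc) (h0d.trans hdd)
      nlinarith

/-- **OS-CLAIM for sets**: two arcs `S, S⁺` pay for the two crossed pairs `(X, Y⁺)`, `(Y, X⁺)` when `X ⊆ X⁺ ⊆ S⁺`, `Y ⊆ Y⁺ ⊆ S⁺`, `X, Y ⊆ S`: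
`0 ≤ Δ(S, ∅) + Δ(S⁺, ∅) + Δ(X, Y⁺) + Δ(Y, X⁺)` for monotone `F, G` (`Δ(U,V) = (F U − F V)(G U − G V)`). [this work] -/
theorem os_claim_sets {α : Type*} {F G : Set α → ℝ} (hF : Monotone F) (hG : Monotone G) {S Sp X Xp Y Yp : Set α}
    (hX : X ⊆ Xp) (hY : Y ⊆ Yp) (hXS : X ⊆ S) (hYS : Y ⊆ S) (hXp : Xp ⊆ Sp) (hYp : Yp ⊆ Sp) :
    0 ≤ (F S - F ∅) * (G S - G ∅) + (F Sp - F ∅) * (G Sp - G ∅) + (F X - F Yp) * (G X - G Yp) + (F Y - F Xp) * (G Y - G Xp) := by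
  have e0 : (∅ : Set α) ⊆ X := Set.empty_subset _
  have e1 : (∅ : Set α) ⊆ Y := Set.empty_subset _
  have key := os_claim (A := F S - F ∅) (Ap := F Sp - F ∅) (a := F X - F ∅) (ap := F Xp - F ∅) (c := F Y - F ∅) (cp := F Yp - F ∅)
    (B := G S - G ∅) (Bp := G Sp - G ∅) (b := G X - G ∅) (bp := G Xp - G ∅) (d := G Y - G ∅) (dp := G Yp - G ∅)
    (sub_nonneg.2 (hF e0)) (sub_nonneg.2 (hF e1)) (sub_nonneg.2 (hG e0)) (sub_nonneg.2 (hG e1))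
    (sub_le_sub_right (hF hX) _) (sub_le_sub_right (hF hY) _) (sub_le_sub_right (hG hX) _) (sub_le_sub_right (hG hY) _)
    (sub_le_sub_right (hF hXS) _) (sub_le_sub_right (hF hYS) _) (sub_le_sub_right (hF hXp) _) (sub_le_sub_right (hF hYp) _)
    (sub_le_sub_right (hG hXS) _) (sub_le_sub_right (hG hYS) _) (sub_le_sub_right (hG hXp) _) (sub_le_sub_right (hG hYp) _)
  have r1 : (F X - F ∅ - (F Yp - F ∅)) = F X - F Yp := by ring
  have r2 : (G X - G ∅ - (G Yp - G ∅)) = G X - G Yp := by ring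
  have r3 : (F Y - F ∅ - (F Xp - F ∅)) = F Y - F Xp := by ring
  have r4 : (G Y - G ∅ - (G Xp - G ∅)) = G Y - G Xp := by ring
  rw [r1, r2, r3, r4] at key
  exact key

end Quad

end Antithetic

end Summit.CriticalPhenomena.PercolationContinuityZ3.Theorems
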